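import Summits.ABC.IUTFork.Repair.RHSigmaMass
import Summits.ABC.IUTFork.Repair.RHCellWeightsBed
import Summits.ABC.IUTFork.Conditional.AbcOfSigmaMassDisplay
import HarnessLib

/-!
# R-H ROUND 2, Q1′ (i)/(ii) JUNCTION: rh2-T-1's trivial-mass numbers AT THE BED are the pilot gap — `M = totalTrivialMass = deĝ_lgp(P_Θ) − deĝ(P_q)`,
# `B_triv(σᶜ) = gap − mass(σ)`, `T(tol) = gap − tol`; at a genuine Θ-volume datum with the chosen ideles `M = T.gap` and `T(Tol) = gapThreshold T`

abc-iut cell, rung LADDER-ABC:A2.RESCUE.H; R-H ROUND 2 seat abc-iut-rh2-w-1 (Q1′ WEIGHTS typer, kernel side). PROOF-ONLY file (0 definitions,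
0 `Prop` facts), the junction abc-iut-rh2-T-1's `Repair/RHSigmaMass.lean` leaves to this seat («the identification `M = (κ−1)·|−|log(q)||` and its
comparison with `T.gap` are abc-iut-rh2-w-1's item (i), not restated here»), written IN rh2-T-1's vocabulary (`RH.SigmaMass.cellTrivialCost`,
`onTrivialMass` = `mass(σ)`, `offTrivialMass` = `B_triv(σᶜ)`, `totalTrivialMass` = `M`, `massThreshold P tol` = `T`; `Conditional.SigmaMass.tol`,
`gapThreshold`) over this seat's `Repair/RHCellWeights.lean` / `RHCellWeightsBed.lean` (p476759 / p477616 / p477159: the spelled-out weight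
`t(i,v_ℚ) = ((i+1)²−1)·(−qLocal_{i+1,v_ℚ})`, `totalMass_settingPrVolSharp_eq_pilotGap`, `pilotGap_pilotDataOfK_eq_pilotData`). Nothing of either is restated.
* §1 AT THE BED `settingPrVolSharp X` (ANY Dupuy–Hilado pilot datum, REALISING Θ- and q-ideles): `cellTrivialCost_settingPrVolSharp_eq_pilotGapWeight`
  (rh2-T-1's NAMED cost IS `t`, via its `cellTrivialCost_settingPrVolSharp_eq` and this seat's `pilotGapSummand_eq`); `onTrivialMass_settingPrVolSharp_eq_mass`;
  **`totalTrivialMass_settingPrVolSharp_eq_pilotGap`** (`M = deĝ_lgp(P_Θ) − deĝ(P_q)`); `offTrivialMass_settingPrVolSharp_eq` (`B_triv(σᶜ) = gap − mass(σ)` —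
  an EQUALITY, by rh2-T-1's `onTrivialMass_add_offTrivialMass`); `massThreshold_settingPrVolSharp_eq` (`T(tol) = gap − tol`).
* §2 AT A GENUINE Θ-VOLUME DATUM `T` of `(P, l)`, at the bed of `Conditional.SigmaMass.cor312UpTo_offTrivialMass_of_licenceOn_chosen` (abc-iut-c312-7's
  sharp setting over `T.K` at `pilotDataOfK T.D T.K`, CHOSEN realising ideles `Cor312Prov.exists_realising_{q,theta}Ideles_pilotDataOfK`):
  **`totalTrivialMass_chosen_eq_gap`** (`M = T.gap` — the two readings «M» (MIN-SLICE (i)) and «gap» (xi-1's tolerance currency, `PointDict.gap_eq`: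
  `((l+1)/24 − 1/(2l))·log(q^{∤{2,l}})`) are ONE number in kernel, as abc-iut-rh-kit-2 PASS 18c tabulated (781/781));
  **`massThreshold_chosen_eq_gapThreshold`** (`massThreshold P (Tol(P,l)) = gapThreshold T` — MIN-SLICE (ii)'s two thresholds coincide);
  `onTrivialMass_add_offTrivialMass_chosen_eq_gap` (`mass(σ) + B_triv(σᶜ) = T.gap`) and **`offTrivialMass_le_iff_gap_sub_le_onTrivialMass_chosen`**
  ([THR] «`B_triv(σᶜ) ≤ tol`» ⟺ «`T.gap − tol ≤ mass(σ)`»): C-R65's loss factor `1/μ`, `μ = mass(σ)/T.gap`, is a quotient of NAMED kernel numbers.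
HONEST FRAMING: identities about OUR typed quantities at the genuine bed; nothing here asserts that abc is proved or refuted, or that [IUTchIII] Cor. 3.12
holds or fails at any datum, or takes a side on any author; `LicenceOn`/[THR] stay HYPOTHESES of rh2-T-1's endpoint (R14 tag); typed ≠ proved;
computed ≠ proved. [claim: Mochizuki2012, status: disputed] for every IUT locution. [cite: Mochizuki2012, IUTchIII Cor. 3.12 p. 173–174; IUTchIV Thm. 1.10
p. 23, Step (viii) p. 30] [cite: DupuyHilado2025, §3.3, Thm. 3.10.1]
-/

noncomputable section

open Set Function NumberField IsDedekindDomain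
open scoped Pointwise

namespace Summit.ABC.IUTFork.Repair.RH.CellWeights

open Summit.ABC.IUTFork.Thm311 Summit.ABC.IUTFork.Thm311.Real Summit.ABC.IUTFork.Cor312 Summit.ABC.IUTFork.Cor312.Setting
  Summit.ABC.IUTFork.Cor312Vol Summit.ABC.IUTFork.Cor312Prov Literature.IUT.LogThetaLattice Literature.IUT.LogVolume
  Literature.IUT.HodgeTheaters Literature.IUT.LogVolume.ThetaData
  Literature.NumberTheory.DiophantineGeometry.GenEll
  Summit.ABC.IUTFork.Repair.RH.SigmaLicence Summit.ABC.IUTFork.Repair.RH.SigmaStrataEq Summit.ABC.IUTFork.Repair.RH.SigmaMass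
  Summit.ABC.IUTFork.Conditional

/-! ## §1. At the bed `settingPrVolSharp X`: rh2-T-1's named numbers in the currency of the pilot gap -/

section Bed

variable {F : Type} [Field F] [NumberField F] (X : PilotData F) {logv : PadicLogs F} (hlog : LogvAnalytic logv)
  (M : Type) [Field M] [NumberField M]
  (archPk : ∀ (j : (thetaIndex X).Label) (vQ : (thetaIndex X).VQ), Set ((logShellsDH X logv).Packet j vQ))
  (archSub : ∀ (j : (thetaIndex X).Label) (v : (thetaIndex X).V),
    Set ((logShellsDH X logv).Packet j ((thetaIndex X).over v)))
  (Ψ : ℤ → ∀ v : (thetaIndex X).V, v ∈ (thetaIndex X).Vbad → Set ((logShellsDH X logv).StarPacket v))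
  (act : ℤ → ∀ v : (thetaIndex X).V, v ∈ (thetaIndex X).Vbad →
    (logShellsDH X logv).StarPacket v → Module.End ℚ ((logShellsDH X logv).StarPacket v))
  (Mmod : ℤ → ∀ j : (thetaIndex X).LabelStar, Set ((logShellsDH X logv).GlobalPacket j.1))
  (region : ℤ → ∀ j : (thetaIndex X).LabelStar, FinDivisor M → ∀ vQ : (thetaIndex X).VQ,
    Set ((logShellsDH X logv).Packet j.1 vQ))
  (n : ℤ) {HT : Type} {LogLink : HT → HT → Type} {IsFull : ∀ {s t : HT}, LogLink s t → Prop}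
  (lat : LGPGaussianLogThetaLattice LogLink IsFull)
  {Frd : Type} {IsoF : Frd → Frd → Type} {Ob : Frd → Type} {realify : Frd → Frd} {Strip : Type}
  {IsoS : Strip → Strip → Type} {Mv : ∀ v : (thetaIndex X).V, v ∈ (thetaIndex X).Vbad → Type}
  [∀ v h, Monoid (Mv v h)]
  (sig : GlobalLGPFrobenioidSignature (thetaIndex X).lstar (thetaIndex X).V (· ∈ (thetaIndex X).Vbad)
    Frd IsoF Ob realify Strip IsoS Mv)
  (split : SplittingMonoids Mv) {ObΔ : Type} {N : ∀ v : (thetaIndex X).V, v ∈ (thetaIndex X).Vbad → Type}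
  [∀ v h, Monoid (N v h)] (qData : QPilotData ObΔ N)
  (tq : ∀ (pp : Nat.Primes) (x : (thetaIndex X).Fibre (.inr pp)), haveI : Fact (pp : ℕ).Prime := ⟨pp.2⟩; kOf X pp.1 x)
  (t : ∀ (pp : Nat.Primes) (_ : Fin X.lstar) (x : (thetaIndex X).Fibre (.inr pp)),
    haveI : Fact (pp : ℕ).Prime := ⟨pp.2⟩; kOf X pp.1 x)
  (htq0 : ∀ pp x, tq pp x ≠ 0)
  (htq1 : ∀ (pp : Nat.Primes) (x : (thetaIndex X).Fibre (.inr pp)),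
    haveI : Fact (pp : ℕ).Prime := ⟨pp.2⟩; placeOf X pp.1 x ∉ X.S → ‖tq pp x‖ = 1)
  (ht0 : ∀ pp i x, t pp i x ≠ 0)
  (ht1 : ∀ (pp : Nat.Primes) (i : Fin X.lstar) (x : (thetaIndex X).Fibre (.inr pp)),
    haveI : Fact (pp : ℕ).Prime := ⟨pp.2⟩; placeOf X pp.1 x ∉ X.S → ‖t pp i x‖ = 1)
  (ht : ∀ (pp : Nat.Primes) (i : Fin X.lstar) (x : (thetaIndex X).Fibre (.inr pp)),
    haveI : Fact (pp : ℕ).Prime := ⟨pp.2⟩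
    Real.log ‖t pp i x‖ = -(X.thetaPilot i (placeOf X pp.1 x)) * logNorm F (placeOf X pp.1 x) / localDegree F (placeOf X pp.1 x))
  (htq : ∀ (pp : Nat.Primes) (x : (thetaIndex X).Fibre (.inr pp)),
    haveI : Fact (pp : ℕ).Prime := ⟨pp.2⟩
    Real.log ‖tq pp x‖ = -(X.qPilot (placeOf X pp.1 x)) * logNorm F (placeOf X pp.1 x) / localDegree F (placeOf X pp.1 x))

include ht0 ht htq in
/-- **rh2-T-1's NAMED trivial cost IS this seat's spelled-out weight** `t(i,v_ℚ) = ((i+1)²−1)·(−qLocal_{i+1,v_ℚ})` at every cell of the bed, for realising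
ideles (`RH.SigmaMass.cellTrivialCost_settingPrVolSharp_eq` ∘ `pilotGapSummand_eq`), as functions on `𝔽_l^⋇ × V_ℚ`. [cite: DupuyHilado2025, §3.3, Thm. 3.10.1]
[claim: Mochizuki2012, status: disputed] -/
theorem cellTrivialCost_settingPrVolSharp_eq_pilotGapWeight :
    cellTrivialCost (settingPrVolSharp X hlog M archPk archSub Ψ act Mmod region n lat sig split qData tq t htq0 htq1) =
      fun c : Fin (thetaIndex X).lstar × (thetaIndex X).VQ => ((((c.1 : ℕ) : ℝ) + 1) ^ 2 - 1) *
        (-(settingPrVolSharp X hlog M archPk archSub Ψ act Mmod region n lat sig split qData tq t htq0 htq1).qLocal (labelSucc c.1) c.2) := by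
  funext c
  rw [cellTrivialCost_settingPrVolSharp_eq X hlog M archPk archSub Ψ act Mmod region n lat sig split qData tq t htq0 htq1 ht0 ht htq c,
    pilotGapSummand_eq X hlog M archPk archSub Ψ act Mmod region n lat sig split qData tq t htq0 htq1 c]

include ht0 ht htq in
/-- **`mass(σ)` in pilot-gap currency**: rh2-T-1's `onTrivialMass P σ` IS `PN(i ↦ Σᶠ_{v_ℚ} 1_σ(i,v_ℚ)·t(i,v_ℚ))` at the bed (realising ideles) — the
quantity of `mass_labelSegment_eq` / MIN-SLICE (iii)'s «mass(Σ_data)» column. [claim: Mochizuki2012, status: disputed] -/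
theorem onTrivialMass_settingPrVolSharp_eq_mass (σ : Set (Fin (thetaIndex X).lstar × (thetaIndex X).VQ)) :
    onTrivialMass (settingPrVolSharp X hlog M archPk archSub Ψ act Mmod region n lat sig split qData tq t htq0 htq1) σ =
      processionNormalized (fun i : Fin (thetaIndex X).lstar => ∑ᶠ vQ : (thetaIndex X).VQ,
        σ.indicator (fun c : Fin (thetaIndex X).lstar × (thetaIndex X).VQ => ((((c.1 : ℕ) : ℝ) + 1) ^ 2 - 1) *
          (-(settingPrVolSharp X hlog M archPk archSub Ψ act Mmod region n lat sig split qData tq t htq0 htq1).qLocal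
            (labelSucc c.1) c.2)) (i, vQ)) := by
  unfold onTrivialMass
  rw [cellTrivialCost_settingPrVolSharp_eq_pilotGapWeight X hlog M archPk archSub Ψ act Mmod region n lat sig split qData tq t htq0 htq1
    ht0 ht htq]

include ht0 ht htq in
/-- **`M = deĝ_lgp(P_Θ) − deĝ(P_q)`**: rh2-T-1's `totalTrivialMass` of the bed IS the Dupuy–Hilado pilot gap of `X` (realising ideles) — this seat's
`totalMass_settingPrVolSharp_eq_pilotGap` read through `cellTrivialCost_settingPrVolSharp_eq_pilotGapWeight`. [cite: DupuyHilado2025, §3.3, Thm. 3.10.1]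
[cite: DupuyHilado2020, §7.12 p. 28] [claim: Mochizuki2012, status: disputed] -/
theorem totalTrivialMass_settingPrVolSharp_eq_pilotGap :
    totalTrivialMass (settingPrVolSharp X hlog M archPk archSub Ψ act Mmod region n lat sig split qData tq t htq0 htq1) =
      LgpDivisor.ndegLgp X.thetaPilot - FinDivisor.ndeg F X.qPilot := by
  unfold totalTrivialMass
  rw [cellTrivialCost_settingPrVolSharp_eq_pilotGapWeight X hlog M archPk archSub Ψ act Mmod region n lat sig split qData tq t htq0 htq1
    ht0 ht htq]
  exact totalMass_settingPrVolSharp_eq_pilotGap X hlog M archPk archSub Ψ act Mmod region n lat sig split qData tq t htq0 htq1 htq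

include ht0 ht1 ht htq in
/-- **`B_triv(σᶜ) = gap − mass(σ)` EXACTLY** for every stratum `σ` at the bed (rh2-T-1's `onTrivialMass_add_offTrivialMass` + `M = gap`).
[claim: Mochizuki2012, status: disputed] -/
theorem offTrivialMass_settingPrVolSharp_eq (σ : Set (Fin (thetaIndex X).lstar × (thetaIndex X).VQ)) :
    offTrivialMass (settingPrVolSharp X hlog M archPk archSub Ψ act Mmod region n lat sig split qData tq t htq0 htq1) σ =
      (LgpDivisor.ndegLgp X.thetaPilot - FinDivisor.ndeg F X.qPilot) -
        onTrivialMass (settingPrVolSharp X hlog M archPk archSub Ψ act Mmod region n lat sig split qData tq t htq0 htq1) σ := by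
  have H := bridgeHyps_settingPrVolSharp_of_ideles X hlog M archPk archSub Ψ act Mmod region n lat sig split qData t tq ht0 ht1 htq0 htq1
  rw [← totalTrivialMass_settingPrVolSharp_eq_pilotGap X hlog M archPk archSub Ψ act Mmod region n lat sig split qData tq t htq0 htq1 ht0 ht htq,
    ← onTrivialMass_add_offTrivialMass H σ]
  ring

include ht0 ht htq in
/-- **`T(tol) = gap − tol`**: rh2-T-1's licence-mass threshold at the bed. [claim: Mochizuki2012, status: disputed] -/
theorem massThreshold_settingPrVolSharp_eq (tol : ℝ) :
    massThreshold (settingPrVolSharp X hlog M archPk archSub Ψ act Mmod region n lat sig split qData tq t htq0 htq1) tol =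
      (LgpDivisor.ndegLgp X.thetaPilot - FinDivisor.ndeg F X.qPilot) - tol := by
  unfold massThreshold
  rw [totalTrivialMass_settingPrVolSharp_eq_pilotGap X hlog M archPk archSub Ψ act Mmod region n lat sig split qData tq t htq0 htq1 ht0 ht htq]

end Bed

/-! ## §2. At a genuine Θ-volume datum with the CHOSEN realising ideles: `M = T.gap`, `T(Tol) = gapThreshold T`, [THR] in gap currency -/

section Datum

/-- **`M = T.gap` AT THE DATUM.** For every genuine Θ-volume datum `T` of `(P, l)` and every context of abc-iut-c312-7's sharp print-normalised setting over
`T.K` at `pilotDataOfK T.D T.K` with the CHOSEN realising ideles (the bed of `Conditional.SigmaMass.cor312UpTo_offTrivialMass_of_licenceOn_chosen`):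
rh2-T-1's total trivial mass IS `T.gap = deĝ_lgp(P_Θ) − deĝ(P_q)` of the datum (`Cor22.ThetaVolumeDatumAt.gap`; closed form `PointDict.gap_eq`:
`((l+1)/24 − 1/(2l))·log(q^{∤{2,l}})`) — §1 at `X := pilotDataOfK T.D T.K`, `pilotGap_pilotDataOfK_eq_pilotData` ([IUTchIV] Thm. 1.10 p. 23: «independent of
the choice of `F□`») and `T.isVolumeInputOf.X_eq`. [cite: Mochizuki2012, IUTchIV Thm. 1.10 p. 23, Step (viii) p. 30] [claim: Mochizuki2012, status: disputed] -/
theorem totalTrivialMass_chosen_eq_gap {P : NFPoint} {l : ℕ} (T : Cor22.ThetaVolumeDatumAt P l) :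
    letI := T.instFieldF; letI := T.instNumberFieldF; letI := T.instAlgebraF; letI := T.instFieldK;
        letI := T.instNumberFieldK; letI := T.instAlgebraK; letI := T.instFieldFbar; letI := T.instAlgebraFbar;
        letI := T.instAlgebraKFbar; letI := T.instIsElliptic;
    ∀ (M : Type) [Field M] [NumberField M]
      (archPk : ∀ (j : (thetaIndex (pilotDataOfK T.D T.K)).Label) (vQ : (thetaIndex (pilotDataOfK T.D T.K)).VQ),
        Set ((logShellsDH (pilotDataOfK T.D T.K) (analyticLogv T.K)).Packet j vQ))
      (archSub : ∀ (j : (thetaIndex (pilotDataOfK T.D T.K)).Label) (v : (thetaIndex (pilotDataOfK T.D T.K)).V),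
        Set ((logShellsDH (pilotDataOfK T.D T.K) (analyticLogv T.K)).Packet j ((thetaIndex (pilotDataOfK T.D T.K)).over v)))
      (Ψ : ℤ → ∀ v : (thetaIndex (pilotDataOfK T.D T.K)).V, v ∈ (thetaIndex (pilotDataOfK T.D T.K)).Vbad →
        Set ((logShellsDH (pilotDataOfK T.D T.K) (analyticLogv T.K)).StarPacket v))
      (act : ℤ → ∀ v : (thetaIndex (pilotDataOfK T.D T.K)).V, v ∈ (thetaIndex (pilotDataOfK T.D T.K)).Vbad →
        (logShellsDH (pilotDataOfK T.D T.K) (analyticLogv T.K)).StarPacket v →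
          Module.End ℚ ((logShellsDH (pilotDataOfK T.D T.K) (analyticLogv T.K)).StarPacket v))
      (Mmod : ℤ → ∀ j : (thetaIndex (pilotDataOfK T.D T.K)).LabelStar,
        Set ((logShellsDH (pilotDataOfK T.D T.K) (analyticLogv T.K)).GlobalPacket j.1))
      (region : ℤ → ∀ j : (thetaIndex (pilotDataOfK T.D T.K)).LabelStar, FinDivisor M →
        ∀ vQ : (thetaIndex (pilotDataOfK T.D T.K)).VQ, Set ((logShellsDH (pilotDataOfK T.D T.K) (analyticLogv T.K)).Packet j.1 vQ))
      (n : ℤ) {HT : Type} {LogLink : HT → HT → Type} {IsFull : ∀ {s t : HT}, LogLink s t → Prop}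
      (lat : LGPGaussianLogThetaLattice LogLink IsFull)
      {Frd : Type} {IsoF : Frd → Frd → Type} {Ob : Frd → Type} {realify : Frd → Frd} {Strip : Type}
      {IsoS : Strip → Strip → Type}
      {Mv : ∀ v : (thetaIndex (pilotDataOfK T.D T.K)).V, v ∈ (thetaIndex (pilotDataOfK T.D T.K)).Vbad → Type}
      [∀ v h, Monoid (Mv v h)]
      (sig : GlobalLGPFrobenioidSignature (thetaIndex (pilotDataOfK T.D T.K)).lstar (thetaIndex (pilotDataOfK T.D T.K)).V
        (· ∈ (thetaIndex (pilotDataOfK T.D T.K)).Vbad) Frd IsoF Ob realify Strip IsoS Mv)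
      (split : SplittingMonoids Mv) {ObΔ : Type}
      {N : ∀ v : (thetaIndex (pilotDataOfK T.D T.K)).V, v ∈ (thetaIndex (pilotDataOfK T.D T.K)).Vbad → Type} [∀ v h, Monoid (N v h)]
      (qData : QPilotData ObΔ N),
      totalTrivialMass
        (settingPrVolSharp (pilotDataOfK T.D T.K) (logvAnalytic_analyticLogv (F := T.K)) M archPk archSub Ψ act Mmod region n lat
          sig split qData (exists_realising_qIdeles_pilotDataOfK T.D).choose (exists_realising_thetaIdeles_pilotDataOfK T.D).choose
          (exists_realising_qIdeles_pilotDataOfK T.D).choose_spec.1 (exists_realising_qIdeles_pilotDataOfK T.D).choose_spec.2.1) = T.gap := by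
  intro M _ _ archPk archSub Ψ act Mmod region n HT LogLink IsFull lat Frd IsoF Ob realify Strip IsoS Mv _ sig split ObΔ N _ qData
  letI := T.instFieldF; letI := T.instNumberFieldF; letI := T.instAlgebraF; letI := T.instFieldK
  letI := T.instNumberFieldK; letI := T.instAlgebraK; letI := T.instFieldFbar; letI := T.instAlgebraFbar
  letI := T.instAlgebraKFbar; letI := T.instIsElliptic
  rw [totalTrivialMass_settingPrVolSharp_eq_pilotGap (pilotDataOfK T.D T.K) (logvAnalytic_analyticLogv (F := T.K)) M archPk archSub Ψ act
      Mmod region n lat sig split qData (exists_realising_qIdeles_pilotDataOfK T.D).choose (exists_realising_thetaIdeles_pilotDataOfK T.D).choose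
      (exists_realising_qIdeles_pilotDataOfK T.D).choose_spec.1 (exists_realising_qIdeles_pilotDataOfK T.D).choose_spec.2.1
      (exists_realising_thetaIdeles_pilotDataOfK T.D).choose_spec.1 (exists_realising_thetaIdeles_pilotDataOfK T.D).choose_spec.2.2
      (exists_realising_qIdeles_pilotDataOfK T.D).choose_spec.2.2,
    pilotGap_pilotDataOfK_eq_pilotData T.D]
  show _ = LgpDivisor.ndegLgp T.I.X.thetaPilot - FinDivisor.ndeg _ T.I.X.qPilot
  rw [T.isVolumeInputOf.X_eq]

/-- **MIN-SLICE (ii)'s TWO THRESHOLDS ARE ONE NUMBER**: at the datum's bed with the chosen ideles, rh2-T-1's `massThreshold P (Tol(P,l)) = M − Tol` IS its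
`gapThreshold T = T.gap − Tol` (`Conditional.SigmaMass.tol`, `gapThreshold`). [claim: Mochizuki2012, status: disputed] -/
theorem massThreshold_chosen_eq_gapThreshold {P : NFPoint} {l : ℕ} (T : Cor22.ThetaVolumeDatumAt P l) :
    letI := T.instFieldF; letI := T.instNumberFieldF; letI := T.instAlgebraF; letI := T.instFieldK;
        letI := T.instNumberFieldK; letI := T.instAlgebraK; letI := T.instFieldFbar; letI := T.instAlgebraFbar;
        letI := T.instAlgebraKFbar; letI := T.instIsElliptic;
    ∀ (M : Type) [Field M] [NumberField M]
      (archPk : ∀ (j : (thetaIndex (pilotDataOfK T.D T.K)).Label) (vQ : (thetaIndex (pilotDataOfK T.D T.K)).VQ),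
        Set ((logShellsDH (pilotDataOfK T.D T.K) (analyticLogv T.K)).Packet j vQ))
      (archSub : ∀ (j : (thetaIndex (pilotDataOfK T.D T.K)).Label) (v : (thetaIndex (pilotDataOfK T.D T.K)).V),
        Set ((logShellsDH (pilotDataOfK T.D T.K) (analyticLogv T.K)).Packet j ((thetaIndex (pilotDataOfK T.D T.K)).over v)))
      (Ψ : ℤ → ∀ v : (thetaIndex (pilotDataOfK T.D T.K)).V, v ∈ (thetaIndex (pilotDataOfK T.D T.K)).Vbad →
        Set ((logShellsDH (pilotDataOfK T.D T.K) (analyticLogv T.K)).StarPacket v))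
      (act : ℤ → ∀ v : (thetaIndex (pilotDataOfK T.D T.K)).V, v ∈ (thetaIndex (pilotDataOfK T.D T.K)).Vbad →
        (logShellsDH (pilotDataOfK T.D T.K) (analyticLogv T.K)).StarPacket v →
          Module.End ℚ ((logShellsDH (pilotDataOfK T.D T.K) (analyticLogv T.K)).StarPacket v))
      (Mmod : ℤ → ∀ j : (thetaIndex (pilotDataOfK T.D T.K)).LabelStar,
        Set ((logShellsDH (pilotDataOfK T.D T.K) (analyticLogv T.K)).GlobalPacket j.1))
      (region : ℤ → ∀ j : (thetaIndex (pilotDataOfK T.D T.K)).LabelStar, FinDivisor M →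
        ∀ vQ : (thetaIndex (pilotDataOfK T.D T.K)).VQ, Set ((logShellsDH (pilotDataOfK T.D T.K) (analyticLogv T.K)).Packet j.1 vQ))
      (n : ℤ) {HT : Type} {LogLink : HT → HT → Type} {IsFull : ∀ {s t : HT}, LogLink s t → Prop}
      (lat : LGPGaussianLogThetaLattice LogLink IsFull)
      {Frd : Type} {IsoF : Frd → Frd → Type} {Ob : Frd → Type} {realify : Frd → Frd} {Strip : Type}
      {IsoS : Strip → Strip → Type}
      {Mv : ∀ v : (thetaIndex (pilotDataOfK T.D T.K)).V, v ∈ (thetaIndex (pilotDataOfK T.D T.K)).Vbad → Type}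
      [∀ v h, Monoid (Mv v h)]
      (sig : GlobalLGPFrobenioidSignature (thetaIndex (pilotDataOfK T.D T.K)).lstar (thetaIndex (pilotDataOfK T.D T.K)).V
        (· ∈ (thetaIndex (pilotDataOfK T.D T.K)).Vbad) Frd IsoF Ob realify Strip IsoS Mv)
      (split : SplittingMonoids Mv) {ObΔ : Type}
      {N : ∀ v : (thetaIndex (pilotDataOfK T.D T.K)).V, v ∈ (thetaIndex (pilotDataOfK T.D T.K)).Vbad → Type} [∀ v h, Monoid (N v h)]
      (qData : QPilotData ObΔ N),
      massThreshold
        (settingPrVolSharp (pilotDataOfK T.D T.K) (logvAnalytic_analyticLogv (F := T.K)) M archPk archSub Ψ act Mmod region n lat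
          sig split qData (exists_realising_qIdeles_pilotDataOfK T.D).choose (exists_realising_thetaIdeles_pilotDataOfK T.D).choose
          (exists_realising_qIdeles_pilotDataOfK T.D).choose_spec.1 (exists_realising_qIdeles_pilotDataOfK T.D).choose_spec.2.1)
        (SigmaMass.tol P l) = SigmaMass.gapThreshold T := by
  intro M _ _ archPk archSub Ψ act Mmod region n HT LogLink IsFull lat Frd IsoF Ob realify Strip IsoS Mv _ sig split ObΔ N _ qData
  unfold massThreshold SigmaMass.gapThreshold
  rw [totalTrivialMass_chosen_eq_gap T M archPk archSub Ψ act Mmod region n lat sig split qData]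

/-- **`mass(σ) + B_triv(σᶜ) = T.gap`** at the datum's bed with the chosen ideles, for EVERY stratum `σ` (rh2-T-1's knapsack identity in gap currency).
[claim: Mochizuki2012, status: disputed] -/
theorem onTrivialMass_add_offTrivialMass_chosen_eq_gap {P : NFPoint} {l : ℕ} (T : Cor22.ThetaVolumeDatumAt P l) :
    letI := T.instFieldF; letI := T.instNumberFieldF; letI := T.instAlgebraF; letI := T.instFieldK;
        letI := T.instNumberFieldK; letI := T.instAlgebraK; letI := T.instFieldFbar; letI := T.instAlgebraFbar;
        letI := T.instAlgebraKFbar; letI := T.instIsElliptic;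
    ∀ (M : Type) [Field M] [NumberField M]
      (archPk : ∀ (j : (thetaIndex (pilotDataOfK T.D T.K)).Label) (vQ : (thetaIndex (pilotDataOfK T.D T.K)).VQ),
        Set ((logShellsDH (pilotDataOfK T.D T.K) (analyticLogv T.K)).Packet j vQ))
      (archSub : ∀ (j : (thetaIndex (pilotDataOfK T.D T.K)).Label) (v : (thetaIndex (pilotDataOfK T.D T.K)).V),
        Set ((logShellsDH (pilotDataOfK T.D T.K) (analyticLogv T.K)).Packet j ((thetaIndex (pilotDataOfK T.D T.K)).over v)))
      (Ψ : ℤ → ∀ v : (thetaIndex (pilotDataOfK T.D T.K)).V, v ∈ (thetaIndex (pilotDataOfK T.D T.K)).Vbad →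
        Set ((logShellsDH (pilotDataOfK T.D T.K) (analyticLogv T.K)).StarPacket v))
      (act : ℤ → ∀ v : (thetaIndex (pilotDataOfK T.D T.K)).V, v ∈ (thetaIndex (pilotDataOfK T.D T.K)).Vbad →
        (logShellsDH (pilotDataOfK T.D T.K) (analyticLogv T.K)).StarPacket v →
          Module.End ℚ ((logShellsDH (pilotDataOfK T.D T.K) (analyticLogv T.K)).StarPacket v))
      (Mmod : ℤ → ∀ j : (thetaIndex (pilotDataOfK T.D T.K)).LabelStar,
        Set ((logShellsDH (pilotDataOfK T.D T.K) (analyticLogv T.K)).GlobalPacket j.1))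
      (region : ℤ → ∀ j : (thetaIndex (pilotDataOfK T.D T.K)).LabelStar, FinDivisor M →
        ∀ vQ : (thetaIndex (pilotDataOfK T.D T.K)).VQ, Set ((logShellsDH (pilotDataOfK T.D T.K) (analyticLogv T.K)).Packet j.1 vQ))
      (n : ℤ) {HT : Type} {LogLink : HT → HT → Type} {IsFull : ∀ {s t : HT}, LogLink s t → Prop}
      (lat : LGPGaussianLogThetaLattice LogLink IsFull)
      {Frd : Type} {IsoF : Frd → Frd → Type} {Ob : Frd → Type} {realify : Frd → Frd} {Strip : Type}
      {IsoS : Strip → Strip → Type}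
      {Mv : ∀ v : (thetaIndex (pilotDataOfK T.D T.K)).V, v ∈ (thetaIndex (pilotDataOfK T.D T.K)).Vbad → Type}
      [∀ v h, Monoid (Mv v h)]
      (sig : GlobalLGPFrobenioidSignature (thetaIndex (pilotDataOfK T.D T.K)).lstar (thetaIndex (pilotDataOfK T.D T.K)).V
        (· ∈ (thetaIndex (pilotDataOfK T.D T.K)).Vbad) Frd IsoF Ob realify Strip IsoS Mv)
      (split : SplittingMonoids Mv) {ObΔ : Type}
      {N : ∀ v : (thetaIndex (pilotDataOfK T.D T.K)).V, v ∈ (thetaIndex (pilotDataOfK T.D T.K)).Vbad → Type} [∀ v h, Monoid (N v h)]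
      (qData : QPilotData ObΔ N)
      (σ : Set (Fin (thetaIndex (pilotDataOfK T.D T.K)).lstar × (thetaIndex (pilotDataOfK T.D T.K)).VQ)),
      onTrivialMass
          (settingPrVolSharp (pilotDataOfK T.D T.K) (logvAnalytic_analyticLogv (F := T.K)) M archPk archSub Ψ act Mmod region n lat
            sig split qData (exists_realising_qIdeles_pilotDataOfK T.D).choose (exists_realising_thetaIdeles_pilotDataOfK T.D).choose
            (exists_realising_qIdeles_pilotDataOfK T.D).choose_spec.1 (exists_realising_qIdeles_pilotDataOfK T.D).choose_spec.2.1) σ +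
        offTrivialMass
          (settingPrVolSharp (pilotDataOfK T.D T.K) (logvAnalytic_analyticLogv (F := T.K)) M archPk archSub Ψ act Mmod region n lat
            sig split qData (exists_realising_qIdeles_pilotDataOfK T.D).choose (exists_realising_thetaIdeles_pilotDataOfK T.D).choose
            (exists_realising_qIdeles_pilotDataOfK T.D).choose_spec.1 (exists_realising_qIdeles_pilotDataOfK T.D).choose_spec.2.1) σ =
        T.gap := by
  intro M _ _ archPk archSub Ψ act Mmod region n HT LogLink IsFull lat Frd IsoF Ob realify Strip IsoS Mv _ sig split ObΔ N _ qData σ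
  letI := T.instFieldF; letI := T.instNumberFieldF; letI := T.instAlgebraF; letI := T.instFieldK
  letI := T.instNumberFieldK; letI := T.instAlgebraK; letI := T.instFieldFbar; letI := T.instAlgebraFbar
  letI := T.instAlgebraKFbar; letI := T.instIsElliptic
  have H := bridgeHyps_settingPrVolSharp_of_ideles (pilotDataOfK T.D T.K) (logvAnalytic_analyticLogv (F := T.K)) M archPk archSub Ψ act
    Mmod region n lat sig split qData (exists_realising_thetaIdeles_pilotDataOfK T.D).choose (exists_realising_qIdeles_pilotDataOfK T.D).choose
    (exists_realising_thetaIdeles_pilotDataOfK T.D).choose_spec.1 (exists_realising_thetaIdeles_pilotDataOfK T.D).choose_spec.2.1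
    (exists_realising_qIdeles_pilotDataOfK T.D).choose_spec.1 (exists_realising_qIdeles_pilotDataOfK T.D).choose_spec.2.1
  rw [onTrivialMass_add_offTrivialMass H σ]
  exact totalTrivialMass_chosen_eq_gap T M archPk archSub Ψ act Mmod region n lat sig split qData

/-- **[THR] IN GAP CURRENCY**: at the datum's bed with the chosen ideles, for every stratum `σ` and tolerance `tol`,
«`B_triv(σᶜ) ≤ tol`» ⟺ «`T.gap − tol ≤ mass(σ)`» — rh2-T-1's endpoint hypothesis [THR] (`abc_of_licenceOn_of_offTrivialMass_le`, C-R65 END-Σ) is the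
retained-mass condition of MIN-SLICE (ii) against the datum's OWN gap; C-R65's loss factor is `1/μ`, `μ := mass(σ)/T.gap`, both NAMED kernel numbers.
[claim: Mochizuki2012, status: disputed] -/
theorem offTrivialMass_le_iff_gap_sub_le_onTrivialMass_chosen {P : NFPoint} {l : ℕ} (T : Cor22.ThetaVolumeDatumAt P l) :
    letI := T.instFieldF; letI := T.instNumberFieldF; letI := T.instAlgebraF; letI := T.instFieldK;
        letI := T.instNumberFieldK; letI := T.instAlgebraK; letI := T.instFieldFbar; letI := T.instAlgebraFbar;
        letI := T.instAlgebraKFbar; letI := T.instIsElliptic;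
    ∀ (M : Type) [Field M] [NumberField M]
      (archPk : ∀ (j : (thetaIndex (pilotDataOfK T.D T.K)).Label) (vQ : (thetaIndex (pilotDataOfK T.D T.K)).VQ),
        Set ((logShellsDH (pilotDataOfK T.D T.K) (analyticLogv T.K)).Packet j vQ))
      (archSub : ∀ (j : (thetaIndex (pilotDataOfK T.D T.K)).Label) (v : (thetaIndex (pilotDataOfK T.D T.K)).V),
        Set ((logShellsDH (pilotDataOfK T.D T.K) (analyticLogv T.K)).Packet j ((thetaIndex (pilotDataOfK T.D T.K)).over v)))
      (Ψ : ℤ → ∀ v : (thetaIndex (pilotDataOfK T.D T.K)).V, v ∈ (thetaIndex (pilotDataOfK T.D T.K)).Vbad →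
        Set ((logShellsDH (pilotDataOfK T.D T.K) (analyticLogv T.K)).StarPacket v))
      (act : ℤ → ∀ v : (thetaIndex (pilotDataOfK T.D T.K)).V, v ∈ (thetaIndex (pilotDataOfK T.D T.K)).Vbad →
        (logShellsDH (pilotDataOfK T.D T.K) (analyticLogv T.K)).StarPacket v →
          Module.End ℚ ((logShellsDH (pilotDataOfK T.D T.K) (analyticLogv T.K)).StarPacket v))
      (Mmod : ℤ → ∀ j : (thetaIndex (pilotDataOfK T.D T.K)).LabelStar,
        Set ((logShellsDH (pilotDataOfK T.D T.K) (analyticLogv T.K)).GlobalPacket j.1))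
      (region : ℤ → ∀ j : (thetaIndex (pilotDataOfK T.D T.K)).LabelStar, FinDivisor M →
        ∀ vQ : (thetaIndex (pilotDataOfK T.D T.K)).VQ, Set ((logShellsDH (pilotDataOfK T.D T.K) (analyticLogv T.K)).Packet j.1 vQ))
      (n : ℤ) {HT : Type} {LogLink : HT → HT → Type} {IsFull : ∀ {s t : HT}, LogLink s t → Prop}
      (lat : LGPGaussianLogThetaLattice LogLink IsFull)
      {Frd : Type} {IsoF : Frd → Frd → Type} {Ob : Frd → Type} {realify : Frd → Frd} {Strip : Type}
      {IsoS : Strip → Strip → Type}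
      {Mv : ∀ v : (thetaIndex (pilotDataOfK T.D T.K)).V, v ∈ (thetaIndex (pilotDataOfK T.D T.K)).Vbad → Type}
      [∀ v h, Monoid (Mv v h)]
      (sig : GlobalLGPFrobenioidSignature (thetaIndex (pilotDataOfK T.D T.K)).lstar (thetaIndex (pilotDataOfK T.D T.K)).V
        (· ∈ (thetaIndex (pilotDataOfK T.D T.K)).Vbad) Frd IsoF Ob realify Strip IsoS Mv)
      (split : SplittingMonoids Mv) {ObΔ : Type}
      {N : ∀ v : (thetaIndex (pilotDataOfK T.D T.K)).V, v ∈ (thetaIndex (pilotDataOfK T.D T.K)).Vbad → Type} [∀ v h, Monoid (N v h)]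
      (qData : QPilotData ObΔ N)
      (σ : Set (Fin (thetaIndex (pilotDataOfK T.D T.K)).lstar × (thetaIndex (pilotDataOfK T.D T.K)).VQ)) (tol : ℝ),
      offTrivialMass
          (settingPrVolSharp (pilotDataOfK T.D T.K) (logvAnalytic_analyticLogv (F := T.K)) M archPk archSub Ψ act Mmod region n lat
            sig split qData (exists_realising_qIdeles_pilotDataOfK T.D).choose (exists_realising_thetaIdeles_pilotDataOfK T.D).choose
            (exists_realising_qIdeles_pilotDataOfK T.D).choose_spec.1 (exists_realising_qIdeles_pilotDataOfK T.D).choose_spec.2.1) σ ≤ tol ↔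
        T.gap - tol ≤
          onTrivialMass
            (settingPrVolSharp (pilotDataOfK T.D T.K) (logvAnalytic_analyticLogv (F := T.K)) M archPk archSub Ψ act Mmod region n lat
              sig split qData (exists_realising_qIdeles_pilotDataOfK T.D).choose (exists_realising_thetaIdeles_pilotDataOfK T.D).choose
              (exists_realising_qIdeles_pilotDataOfK T.D).choose_spec.1 (exists_realising_qIdeles_pilotDataOfK T.D).choose_spec.2.1) σ := by
  intro M _ _ archPk archSub Ψ act Mmod region n HT LogLink IsFull lat Frd IsoF Ob realify Strip IsoS Mv _ sig split ObΔ N _ qData σ tol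
  have h := onTrivialMass_add_offTrivialMass_chosen_eq_gap T M archPk archSub Ψ act Mmod region n lat sig split qData σ
  constructor <;> intro h' <;> linarith

end Datum

end Summit.ABC.IUTFork.Repair.RH.CellWeights

end
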